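import Mathlib
import HarnessLib
import Summits.ValiantsHypothesis.ValiantsHypothesis.Theorems.LacunarySymmetroidMatrixDescartesProductPlusOneSeparatingWeight

/-!
# ValiantsHypothesis / LacunarySymmetroid — crux `MatrixDescartes` (stmt-ValiantsHypothesis-18050, V1),
# LINE (A) «product_plus_one»: the SHARP PAIRWISE form of the separating-weight law (every format, every coupling)

✓ `sepWeight_euler_pos_roots_le` asks for a weight `λ` with `W_j < λ·s_j` for every row (`s_j = f_j·θ_c f_j` the signed «drive» of the row,
`θ_c = θ − c`, level `ν = m·c`).  Such a `λ` EXISTS iff the rates `τ_j = W_j/s_j` of the rows with `s_j > 0` (risers) all lie strictly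
below those of the rows with `s_j < 0` (pullers), and the rows with `s_j = 0` have `W_j < 0`.  This file types that equivalence's useful
direction, so that a consumer (or a numerics seat testing a located extra zero) checks finitely many PAIRWISE inequalities and never
chooses a weight:

* ★★ `sepWeight_pairwise_pos_roots_le` — every format `(m, K)`, any rows, uniform shift `c`: if at every positive zero of
  `E = X·P′ − C(m c)·P` off the poles (i) every row with zero drive has `W_j < 0` and (ii) every riser/puller pair satisfies
  `W_i·s_j < W_j·s_i` (i.e. `τ_j < τ_i`), then `Z₊(E) ≤ B + (B + 1)` for any bound `Z₊(P) ≤ B`.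
  (For trinomial rows `τ = mean ∓ |φ|`, ✓ `…SeparatingWeight` docstring; the ratio/mean-ordered sectors are the cases where (ii) holds
  for the cheap reason `mean_j ≤ mean_i`.)

HONEST FRAMING: the sharp single-weight criterion, every format; closes nothing; NOT the stubs, not `MatrixDescartes`; `VP ≠ VNP` is NOT
proved.  No definitions, no named facts, no sorry.
-/

set_option linter.dupNamespace false

namespace Summit.ValiantsHypothesis.ValiantsHypothesis.Theorems.LacunarySymmetroidMatrixDescartes

namespace ProductPlusOne

open Polynomial Finset
open scoped BigOperators

/-- ★★ **SHARP PAIRWISE SEPARATING-WEIGHT LAW** (every format, any rows `f_j`, uniform shift `c`, level `ν = m·c`; drives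
`s_j = f_j(z)·(θf_j(z) − c f_j(z))`): if at every positive zero `z` of `E` off the poles every zero-drive row has `W_j(z) < 0` and every pair
(`s_j > 0`, `s_i < 0`) has `W_i·s_j < W_j·s_i`, then `Z₊(E) ≤ B + (B + 1)` for any bound `Z₊(P) ≤ B`. [this file's theorem] -/
theorem sepWeight_pairwise_pos_roots_le {m : ℕ} (f : Fin m → ℝ[X]) (hP0 : (∏ j, f j) ≠ 0) (c : ℝ) (B : ℕ)
    (hZ : ((∏ j, f j).roots.toFinset.filter (fun t => 0 < t)).card ≤ B)
    (hpair : ∀ z : ℝ, 0 < z → (∀ i, (f i).eval z ≠ 0) → (X * derivative (∏ j, f j) - C ((m : ℝ) * c) * ∏ j, f j).eval z = 0 →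
      (∀ j, ((f j).eval z * ((X * derivative (f j)).eval z - c * (f j).eval z)) = 0 → (f j * (X * derivative (X * derivative (f j))) - (X * derivative (f j)) ^ 2).eval z < 0) ∧
      (∀ j i, 0 < ((f j).eval z * ((X * derivative (f j)).eval z - c * (f j).eval z)) → ((f i).eval z * ((X * derivative (f i)).eval z - c * (f i).eval z)) < 0 → (f i * (X * derivative (X * derivative (f i))) - (X * derivative (f i)) ^ 2).eval z * ((f j).eval z * ((X * derivative (f j)).eval z - c * (f j).eval z)) < (f j * (X * derivative (X * derivative (f j))) - (X * derivative (f j)) ^ 2).eval z * ((f i).eval z * ((X * derivative (f i)).eval z - c * (f i).eval z)))) :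
    ((X * derivative (∏ j, f j) - C ((m : ℝ) * c) * ∏ j, f j).roots.toFinset.filter (fun t => 0 < t)).card ≤ B + (B + 1) := by
  classical
  refine sepWeight_euler_pos_roots_le f hP0 ((m : ℝ) * c) B hZ (fun z hz hfz hEz => ?_)
  obtain ⟨hzero, hpairs⟩ := hpair z hz hfz hEz
  -- it suffices to produce one weight `lam` with `W_j < lam * s_j` for every row
  suffices hlam : ∃ lam : ℝ, ∀ j, (f j * (X * derivative (X * derivative (f j))) - (X * derivative (f j)) ^ 2).eval z < lam * ((f j).eval z * ((X * derivative (f j)).eval z - c * (f j).eval z)) by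
    obtain ⟨lam, hrow⟩ := hlam
    exact ⟨lam, fun _ => c, by simp, hrow⟩
  set R : Finset (Fin m) := Finset.univ.filter (fun j => 0 < ((f j).eval z * ((X * derivative (f j)).eval z - c * (f j).eval z))) with hR
  set U : Finset (Fin m) := Finset.univ.filter (fun j => ((f j).eval z * ((X * derivative (f j)).eval z - c * (f j).eval z)) < 0) with hU
  -- the three kinds of rows, given bounds on the rates
  have hrow_of : ∀ lam : ℝ, (∀ j ∈ R, (f j * (X * derivative (X * derivative (f j))) - (X * derivative (f j)) ^ 2).eval z / ((f j).eval z * ((X * derivative (f j)).eval z - c * (f j).eval z)) < lam) → (∀ j ∈ U, lam < (f j * (X * derivative (X * derivative (f j))) - (X * derivative (f j)) ^ 2).eval z / ((f j).eval z * ((X * derivative (f j)).eval z - c * (f j).eval z))) → ∀ j, (f j * (X * derivative (X * derivative (f j))) - (X * derivative (f j)) ^ 2).eval z < lam * ((f j).eval z * ((X * derivative (f j)).eval z - c * (f j).eval z)) := by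
    intro lam hRl hUl j
    rcases lt_trichotomy 0 ((f j).eval z * ((X * derivative (f j)).eval z - c * (f j).eval z)) with hpos | hzero' | hneg
    · have h := hRl j (Finset.mem_filter.mpr ⟨Finset.mem_univ _, hpos⟩)
      exact (div_lt_iff₀ hpos).mp h
    · rw [← hzero', mul_zero]; exact hzero j hzero'.symm
    · have h := hUl j (Finset.mem_filter.mpr ⟨Finset.mem_univ _, hneg⟩)
      exact (lt_div_iff_of_neg hneg).mp h
  by_cases hRne : R.Nonempty
  · obtain ⟨j₀, hj₀, hmax⟩ := R.exists_max_image (fun j => (f j * (X * derivative (X * derivative (f j))) - (X * derivative (f j)) ^ 2).eval z / ((f j).eval z * ((X * derivative (f j)).eval z - c * (f j).eval z))) hRne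
    have hs₀ : 0 < ((f j₀).eval z * ((X * derivative (f j₀)).eval z - c * (f j₀).eval z)) := (Finset.mem_filter.mp hj₀).2
    by_cases hUne : U.Nonempty
    · obtain ⟨i₀, hi₀, hmin⟩ := U.exists_min_image (fun j => (f j * (X * derivative (X * derivative (f j))) - (X * derivative (f j)) ^ 2).eval z / ((f j).eval z * ((X * derivative (f j)).eval z - c * (f j).eval z))) hUne
      have ht₀ : ((f i₀).eval z * ((X * derivative (f i₀)).eval z - c * (f i₀).eval z)) < 0 := (Finset.mem_filter.mp hi₀).2
      -- the extreme rates are strictly ordered, by the pairwise hypothesis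
      have hlt : (f j₀ * (X * derivative (X * derivative (f j₀))) - (X * derivative (f j₀)) ^ 2).eval z / ((f j₀).eval z * ((X * derivative (f j₀)).eval z - c * (f j₀).eval z)) < (f i₀ * (X * derivative (X * derivative (f i₀))) - (X * derivative (f i₀)) ^ 2).eval z / ((f i₀).eval z * ((X * derivative (f i₀)).eval z - c * (f i₀).eval z)) := by
        have hp := hpairs j₀ i₀ hs₀ ht₀
        rw [← sub_neg, div_sub_div _ _ hs₀.ne' ht₀.ne]
        exact div_neg_of_pos_of_neg (by linarith) (mul_neg_of_pos_of_neg hs₀ ht₀)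
      refine ⟨((f j₀ * (X * derivative (X * derivative (f j₀))) - (X * derivative (f j₀)) ^ 2).eval z / ((f j₀).eval z * ((X * derivative (f j₀)).eval z - c * (f j₀).eval z)) + (f i₀ * (X * derivative (X * derivative (f i₀))) - (X * derivative (f i₀)) ^ 2).eval z / ((f i₀).eval z * ((X * derivative (f i₀)).eval z - c * (f i₀).eval z))) / 2, hrow_of _ (fun j hj => ?_) (fun j hj => ?_)⟩
      · have := hmax j hj; linarith
      · have := hmin j hj; linarith
    · refine ⟨(f j₀ * (X * derivative (X * derivative (f j₀))) - (X * derivative (f j₀)) ^ 2).eval z / ((f j₀).eval z * ((X * derivative (f j₀)).eval z - c * (f j₀).eval z)) + 1, hrow_of _ (fun j hj => ?_) (fun j hj => absurd ⟨j, hj⟩ hUne)⟩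
      have := hmax j hj; linarith
  · by_cases hUne : U.Nonempty
    · obtain ⟨i₀, hi₀, hmin⟩ := U.exists_min_image (fun j => (f j * (X * derivative (X * derivative (f j))) - (X * derivative (f j)) ^ 2).eval z / ((f j).eval z * ((X * derivative (f j)).eval z - c * (f j).eval z))) hUne
      refine ⟨(f i₀ * (X * derivative (X * derivative (f i₀))) - (X * derivative (f i₀)) ^ 2).eval z / ((f i₀).eval z * ((X * derivative (f i₀)).eval z - c * (f i₀).eval z)) - 1, hrow_of _ (fun j hj => absurd ⟨j, hj⟩ hRne) (fun j hj => ?_)⟩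
      have := hmin j hj; linarith
    · exact ⟨0, hrow_of 0 (fun j hj => absurd ⟨j, hj⟩ hRne) (fun j hj => absurd ⟨j, hj⟩ hUne)⟩

end ProductPlusOne

end Summit.ValiantsHypothesis.ValiantsHypothesis.Theorems.LacunarySymmetroidMatrixDescartes
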